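import Summits.Ventures.HSemireg.WedgeHankelPointKernel

/-!
# Venture HSemireg — THE KERNEL OF A TRANSVERSE PAIR IS THE INTERSECTION OF THE KERNELS OF ITS TWO EXPONENTIALS:
# `Kr(univ, w_m(Aλ^• + Bμ^•), k) = (Σ_a (x_a + λ y_a) ∧ ⋀^{k−1}) ∩ (Σ_a (x_a + μ y_a) ∧ ⋀^{k−1})` for `0 < k < m` — the Hankel-rank-2 face, named

HONEST FRAMING. Part of the Lean index of the computation cell `pub-hsemireg` (seat p10 gen 13, Sunday typer «UNIFORM-IN-n»).
Finite-dimensional EXTERIOR ALGEBRA over a field and ranks of HANKEL MATRICES ONLY: no variety, no cohomology theory, no sheaf, no Ext group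
and no semiregularity map is constructed here; nothing here says that HC / HC_CM / HC_AV holds; no Literature fact is declared or used.  Custodian
versions cited: theory/FORMULA-N.md PART A §2.2 THEOREM T, §2.6 THEOREM H and its KRONECKER DICTIONARY («ρ = 2 ⟺ two exponentials (K-secant,
real pair, 1 − pt)»), §7 FN-1; PART B §N; STRUCTURE.md v1.0-SIGNED 9b196a05977dd067 §1.1 C15.  The dictionary (`A·exp(λΘ) + B·exp(μΘ)` ↦ th-7's
`w_m(Aλ^j + Bμ^j)`) is QUOTED, never asserted.

WHAT IS KEYED.  `WedgeHankelBox` (585): THEOREM T for the transverse pair, `rank(θ ↦ θ ∧ w_m(Aλ^• + Bμ^•) ∣ ⋀^k) = P_m[k] = 2C(m,k)` for `0 < k < m`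
(`finrank_range_wedge_w_tpSeq`, th-7's shear); `WedgeHankelPureKernel` (C6, 732): the kernel of ONE exponential is the ideal of its frame,
`Kr(univ, w_m(Aλ^•), k) = F_λ(k) := Σ_a (x_a + λ y_a) ∧ Hom(univ, k−1)`, of dimension `C(2m,k) − C(m,k)`.  THIS FILE names the rank-2 face WITHOUT
a second shear, by a dimension squeeze:
* §1 `w` is additive in the coefficients; **`w_tpSeq`: `w_j(Aλ^• + Bμ^•) = A·u^λ₀ ∧ ⋯ ∧ u^λ_{j−1} + B·u^μ₀ ∧ ⋯ ∧ u^μ_{j−1}`** — a transverse pair IS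
  the sum of its two pure classes.
* §2 the easy half **`frameIdeal_inf_le_Kr_tpSeq`: F_λ(k) ∩ F_μ(k) ≤ Kr(univ, w_m(Aλ^• + Bμ^•), k)`** (a form killing both exponentials kills their
  sum); and **`frameIdeal_sup_eq_Hom`: F_λ(k) + F_μ(k) = Hom(univ, k)` for `λ ≠ μ`, `k ≥ 1`** (the two frames together span all generators:
  `y_a = (λ−μ)⁻¹(u^λ_a − u^μ_a)`, `x_a = u^λ_a − λ y_a`), hence **`finrank_frameIdeal_inf`: `dim (F_λ(k) ∩ F_μ(k)) + 2C(m,k) = C(2m,k)`** (`k ≥ 1`).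
* §3 **THE TRANSVERSE-PAIR KERNEL, NAMED — `Kr_w_tpSeq`: for `λ ≠ μ`, `A, B ≠ 0`, `0 < k < m`:
  `Kr(univ, w_m(Aλ^• + Bμ^•), k) = F_λ(k) ∩ F_μ(k)`** — the degree-`k` forms killing a transverse pair are EXACTLY those killing BOTH of its
  exponentials (containment + equal dimensions: `C(2m,k) − 2C(m,k)` on both sides, 585's THEOREM T + C1's rank–nullity); in particular the kernel
  does not see the coefficients `A, B` (`Kr_w_tpSeq_indep`).
In the quoted dictionary: the `HT`-directions killing the class of a K-secant / real-pair object `A e^{λΘ} + B e^{μΘ}` are the directions killing both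
line-bundle classes `e^{λΘ}`, `e^{μΘ}` — FN-1's transverse pairs inherit their kernel from the pure faces.  NOT typed here: the top and middle degrees
`k ≥ m` (purity drop, THEOREM T's exceptional values); the tangent face `(A, B, 0, …, 0)`; anything Ext-side.  Class side only.
Namespace `Summit.Ventures.HSemireg.Wedge.HankelPureKernel` (continued); new names only.
-/

open Module

namespace Summit.Ventures.HSemireg.Wedge.HankelPureKernel

open Summit.Ventures.HSemireg.Wedge Summit.Ventures.HSemireg.Wedge.Kunneth Summit.Ventures.HSemireg.Wedge.KunnethKernel
  Summit.Ventures.HSemireg.Wedge.HankelFaces Summit.Ventures.HSemireg.Wedge.HankelBox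

variable (K : Type*) [Field K] (m : ℕ)

/-! ## §1. A transverse pair is the sum of its two pure classes -/

/-- th-7's Hankel class is additive in its coefficient sequence. -/
lemma w_add' : ∀ (j : ℕ) (q q' : ℕ → K), Hankel.w K m j (q + q') = Hankel.w K m j q + Hankel.w K m j q'
  | 0, q, q' => by rw [Hankel.w, Hankel.w, Hankel.w, Pi.add_apply, add_smul]
  | j + 1, q, q' => by
    rw [Hankel.w, Hankel.w, Hankel.w, show Hankel.shift K (q + q') = Hankel.shift K q + Hankel.shift K q' from rfl, w_add' j, w_add' j,
      add_mul, add_mul]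
    abel

/-- the transverse-pair sequence is the sum of two exponential sequences. -/
lemma tpSeq_eq_add (A B lam mu : K) : tpSeq K A B lam mu = expSeq K A lam + expSeq K B mu := by
  funext j; rfl

/-- **`w_j(Aλ^• + Bμ^•) = A · u^λ₀ ∧ ⋯ ∧ u^λ_{j−1} + B · u^μ₀ ∧ ⋯ ∧ u^μ_{j−1}`**: a transverse pair is the sum of its two (decomposable) pure classes. -/
theorem w_tpSeq (A B lam mu : K) (j : ℕ) :
    Hankel.w K m j (tpSeq K A B lam mu) = A • uprod K m lam j + B • uprod K m mu j := by
  rw [tpSeq_eq_add, w_add', w_expSeq, w_expSeq]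

/-! ## §2. The two frame ideals: their intersection kills the pair, their sum is everything -/

/-- **a form killing both exponentials kills the pair: `F_λ(k) ∩ F_μ(k) ≤ Kr(univ, w_m(Aλ^• + Bμ^•), k)`** (`k ≥ 1`). -/
theorem frameIdeal_inf_le_Kr_tpSeq (A B lam mu : K) {k : ℕ} (hk : 1 ≤ k) :
    frameIdeal K m (uvec K m lam) k ⊓ frameIdeal K m (uvec K m mu) k ≤ Kr K Finset.univ (Hankel.w K m m (tpSeq K A B lam mu)) k := by
  intro θ hθ
  obtain ⟨h1, h2⟩ := Submodule.mem_inf.mp hθ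
  rw [← Kr_w_expSeq K m one_ne_zero lam hk] at h1
  rw [← Kr_w_expSeq K m one_ne_zero mu hk] at h2
  obtain ⟨hH, h1⟩ := mem_Kr.mp h1
  obtain ⟨-, h2⟩ := mem_Kr.mp h2
  rw [w_expSeq, one_smul] at h1 h2
  refine mem_Kr.mpr ⟨hH, ?_⟩
  rw [w_tpSeq, mul_add, mul_smul_comm, mul_smul_comm, h1, h2, smul_zero, smul_zero, add_zero]

/-- the generators lie in the span of two distinct frames: `y_a, x_a ∈ span{u^λ_a, u^μ_a}` for `λ ≠ μ`. -/
lemma Y_mem_span_uvec {lam mu : K} (h : lam ≠ mu) (a : ℕ) :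
    Hankel.Y K m a ∈ Submodule.span K ({uvec K m lam a, uvec K m mu a} : Set (HT K (Hankel.In m))) := by
  have hlm : lam - mu ≠ 0 := sub_ne_zero.mpr h
  have hy : Hankel.Y K m a = (lam - mu)⁻¹ • (uvec K m lam a - uvec K m mu a) := by
    rw [uvec, uvec, add_sub_add_left_eq_sub, ← sub_smul, smul_smul, inv_mul_cancel₀ hlm, one_smul]
  rw [hy]
  exact Submodule.smul_mem _ _ (Submodule.sub_mem _ (Submodule.subset_span (by simp)) (Submodule.subset_span (by simp)))

/-- `x_a ∈ span{u^λ_a, u^μ_a}` for `λ ≠ μ`. -/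
lemma X_mem_span_uvec {lam mu : K} (h : lam ≠ mu) (a : ℕ) :
    Hankel.X K m a ∈ Submodule.span K ({uvec K m lam a, uvec K m mu a} : Set (HT K (Hankel.In m))) := by
  have hx : Hankel.X K m a = uvec K m lam a - lam • Hankel.Y K m a := by rw [uvec, add_sub_cancel_right]
  rw [hx]
  exact Submodule.sub_mem _ (Submodule.subset_span (by simp)) (Submodule.smul_mem _ _ (Y_mem_span_uvec K m h a))

/-- a single generator times `Hom(univ, k−1)` lies in `F_λ(k) + F_μ(k)` when the generator lies in the span of the two frame vectors of its pair. -/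
lemma gx_mul_mem_sup {lam mu : K} {g : HT K (Hankel.In m)} {a : ℕ} (ha : a < m)
    (hg : g ∈ Submodule.span K ({uvec K m lam a, uvec K m mu a} : Set (HT K (Hankel.In m)))) {z : HT K (Hankel.In m)} {k : ℕ}
    (hz : z ∈ Hom K (Hankel.In m) Finset.univ (k - 1)) :
    g * z ∈ frameIdeal K m (uvec K m lam) k ⊔ frameIdeal K m (uvec K m mu) k := by
  rw [Submodule.mem_span_pair] at hg
  obtain ⟨c, d, rfl⟩ := hg
  rw [add_mul, smul_mul_assoc, smul_mul_assoc]
  refine Submodule.add_mem _ (Submodule.mem_sup_left (Submodule.smul_mem _ _ ?_)) (Submodule.mem_sup_right (Submodule.smul_mem _ _ ?_))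
  · exact Submodule.mem_iSup_of_mem a (Submodule.mem_iSup_of_mem (Finset.mem_range.mpr ha)
      (Submodule.mul_mem_mul (Submodule.mem_span_singleton_self _) hz))
  · exact Submodule.mem_iSup_of_mem a (Submodule.mem_iSup_of_mem (Finset.mem_range.mpr ha)
      (Submodule.mul_mem_mul (Submodule.mem_span_singleton_self _) hz))

/-- **the two frame ideals together are everything: `F_λ(k) + F_μ(k) = Hom(univ, k)`** for `λ ≠ μ` and `k ≥ 1` (every degree-`k` monomial starts
with some generator `x_a` or `y_a`, which lies in `span{u^λ_a, u^μ_a}`). -/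
theorem frameIdeal_sup_eq_Hom {lam mu : K} (h : lam ≠ mu) {k : ℕ} (hk : 1 ≤ k) :
    frameIdeal K m (uvec K m lam) k ⊔ frameIdeal K m (uvec K m mu) k = Hom K (Hankel.In m) Finset.univ k := by
  classical
  apply le_antisymm
  · refine sup_le ?_ ?_ <;>
    · rw [← Kr_w_expSeq K m one_ne_zero _ hk]; exact Kr_le_Hom K _ _ _
  · rw [Hom, Submodule.span_le]
    rintro _ ⟨s, ⟨-, hsk⟩, rfl⟩
    obtain ⟨i, hi⟩ : s.Nonempty := Finset.card_pos.mp (by omega)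
    have hsplit : B K (Hankel.In m) s = (u K {i} (s.erase i))⁻¹ • (B K (Hankel.In m) {i} * B K (Hankel.In m) (s.erase i)) := by
      have hdis : Disjoint ({i} : Finset (Hankel.In m)) (s.erase i) := Finset.disjoint_singleton_left.mpr (Finset.notMem_erase i s)
      rw [B_mul_B, smul_smul, inv_mul_cancel₀ ((u_ne_zero_iff K).mpr hdis), one_smul, ← Finset.insert_eq, Finset.insert_erase hi]
    show B K (Hankel.In m) s ∈ _
    rw [hsplit]
    refine Submodule.smul_mem _ _ ?_
    have hz : B K (Hankel.In m) (s.erase i) ∈ Hom K (Hankel.In m) Finset.univ (k - 1) :=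
      B_mem_Hom K (Finset.subset_univ _) (by rw [Finset.card_erase_of_mem hi, hsk])
    have hi2 := i.2
    by_cases him : (i : ℕ) < m
    · have hx : B K (Hankel.In m) {i} = Hankel.X K m i := by
        rw [Hankel.X, dif_pos him, gx]; exact congrArg _ (by ext j; simp [Hankel.xI, Fin.ext_iff])
      rw [hx]
      exact gx_mul_mem_sup K m him (X_mem_span_uvec K m h i) hz
    · have ha : (i : ℕ) - m < m := by omega
      have hy : B K (Hankel.In m) {i} = Hankel.Y K m ((i : ℕ) - m) := by
        rw [Hankel.Y, dif_pos ha, gx]; exact congrArg _ (by ext j; simp [Hankel.yI, Fin.ext_iff]; omega)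
      rw [hy]
      exact gx_mul_mem_sup K m ha (Y_mem_span_uvec K m h _) hz

/-- hence **`dim (F_λ(k) ∩ F_μ(k)) + 2C(m, k) = C(2m, k)`** for `λ ≠ μ`, `k ≥ 1`. -/
theorem finrank_frameIdeal_inf {lam mu : K} (h : lam ≠ mu) {k : ℕ} (hk : 1 ≤ k) :
    finrank K ↥(frameIdeal K m (uvec K m lam) k ⊓ frameIdeal K m (uvec K m mu) k) + 2 * m.choose k = (m + m).choose k := by
  have hsum := Submodule.finrank_sup_add_finrank_inf_eq (frameIdeal K m (uvec K m lam) k) (frameIdeal K m (uvec K m mu) k)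
  rw [frameIdeal_sup_eq_Hom K m h hk, finrank_frameIdeal_uvec K m lam hk, finrank_frameIdeal_uvec K m mu hk] at hsum
  have hH : finrank K ↥(Hom K (Hankel.In m) Finset.univ k) = (m + m).choose k := by
    rw [Hom_univ_eq_exteriorPower, exteriorPower.finrank_eq, finrank_fintype_fun_eq_card, Fintype.card_fin]
  have hle : m.choose k ≤ (m + m).choose k := Nat.choose_le_choose k (by omega)
  omega

/-! ## §3. The transverse-pair kernel, named -/

/-- the transverse pair has kernel dimension `C(2m, k) − 2C(m, k)` for `0 < k < m` (585's THEOREM T + C1's per-degree rank–nullity). -/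
theorem finrank_Kr_w_tpSeq_add (hm : 1 ≤ m) {k : ℕ} (hk : 0 < k) (hkm : k < m) {A B lam mu : K} (hlm : lam ≠ mu) (hA : A ≠ 0) (hB : B ≠ 0) :
    finrank K (Kr K Finset.univ (Hankel.w K m m (tpSeq K A B lam mu)) k) + 2 * m.choose k = (m + m).choose k := by
  have h := finrank_Kr_add_finrank_V K (Finset.univ : Finset (Hankel.In m)) (Hankel.w K m m (tpSeq K A B lam mu)) k
  rw [Finset.card_univ, Fintype.card_fin, V_univ, finrank_range_wedge_w_tpSeq K m hm hkm.le hlm hA hB, WedgePair.pointPairRank,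
    if_neg (by omega), if_neg (by omega), Nat.sub_zero, Nat.sub_zero] at h
  exact h

/-- **THE KERNEL OF A TRANSVERSE PAIR IS THE INTERSECTION OF THE KERNELS OF ITS TWO EXPONENTIALS:
`Kr(univ, w_m(Aλ^• + Bμ^•), k) = F_λ(k) ∩ F_μ(k)`** for `λ ≠ μ`, `A, B ≠ 0` and `0 < k < m` (every field, `m`) — containment and equal dimensions. -/
theorem Kr_w_tpSeq (hm : 1 ≤ m) {k : ℕ} (hk : 0 < k) (hkm : k < m) {A B lam mu : K} (hlm : lam ≠ mu) (hA : A ≠ 0) (hB : B ≠ 0) :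
    Kr K Finset.univ (Hankel.w K m m (tpSeq K A B lam mu)) k = frameIdeal K m (uvec K m lam) k ⊓ frameIdeal K m (uvec K m mu) k := by
  refine (Submodule.eq_of_le_of_finrank_eq (frameIdeal_inf_le_Kr_tpSeq K m A B lam mu hk) ?_).symm
  have h1 := finrank_frameIdeal_inf K m hlm (k := k) hk
  have h2 := finrank_Kr_w_tpSeq_add K m hm hk hkm hlm hA hB
  omega

/-- in particular **the kernel of a transverse pair does not depend on its (non-zero) coefficients**. -/
theorem Kr_w_tpSeq_indep (hm : 1 ≤ m) {k : ℕ} (hk : 0 < k) (hkm : k < m) {A B A' B' lam mu : K} (hlm : lam ≠ mu)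
    (hA : A ≠ 0) (hB : B ≠ 0) (hA' : A' ≠ 0) (hB' : B' ≠ 0) :
    Kr K Finset.univ (Hankel.w K m m (tpSeq K A B lam mu)) k = Kr K Finset.univ (Hankel.w K m m (tpSeq K A' B' lam mu)) k := by
  rw [Kr_w_tpSeq K m hm hk hkm hlm hA hB, Kr_w_tpSeq K m hm hk hkm hlm hA' hB']

/-- wedge form: **`ker(θ ↦ θ ∧ w_m(Aλ^• + Bμ^•) ∣ ⋀^k) = F_λ(k) ∩ F_μ(k)`** (comapped), `0 < k < m`. -/
theorem ker_wedge_w_tpSeq (hm : 1 ≤ m) {k : ℕ} (hk : 0 < k) (hkm : k < m) {A B lam mu : K} (hlm : lam ≠ mu) (hA : A ≠ 0) (hB : B ≠ 0) :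
    LinearMap.ker (wedge K (Hankel.In m) k (Hankel.w K m m (tpSeq K A B lam mu))) =
      (frameIdeal K m (uvec K m lam) k ⊓ frameIdeal K m (uvec K m mu) k).comap (⋀[K]^k (Hankel.In m → K)).subtype := by
  rw [ker_wedge_eq_comap_Kr, Kr_w_tpSeq K m hm hk hkm hlm hA hB]

end Summit.Ventures.HSemireg.Wedge.HankelPureKernel
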